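import Literature.MeasureTheory.Constructions.PiOptionIntegral   -- ★ (LH10-p02): §5 `integral_pi_comp_piCongrLeft`, `integrable_comp_piCongrLeft_iff`, `piCongrLeft_apply_apply`
import HarnessLib

/-!
# Bochner integrals over `Measure.pi`: splitting the index along `ι₁ ⊕ ι₂ ≃ ι` (sum reindexing + Fubini)

Topic `MeasureTheory/Constructions`; namespace `Literature.MeasureTheory.Constructions`.  THEOREMS ONLY (no definition, no instance, no notation, no named fact, no `sorry`);
GENERIC (Mathlib-only).  Cell `pub/hodgecm-mathlib`, crux H413 `stub_N9` (stmt-24833), LH3 leaf organ O-L1d′ (`hCm`): the «Fubini bookkeeping» of F0P3a-p08 (g23) between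
leg (M1) (the isolated product integral `∫_{∏_{w ∈ T} G_w}` over the SUBTYPE `T = {w ∕∕ p w}` of the nc-singular compact places) and the MIXED TOWER of ★
`contDiffOn_and_forall_bound_mixedTower` (outer `∫` over the SCALAR places enumerated by `Fin m₂`, inner `∫` over the FACE places enumerated by `Fin m₁`);
lane `--supports stmt-HodgeConjecture-24833`; it pays no printed statement.

THE MATHEMATICS.  For a finite index `ι`, measurable spaces `β i` with σ-finite measures `μ i`, and an equivalence `e : ι₁ ⊕ ι₂ ≃ ι` (finite `ι₁`, `ι₂`), the measurable
equivalence `Ψ := MeasurableEquiv.piCongrLeft β e ∘ (MeasurableEquiv.sumPiEquivProdPi (β ∘ e)).symm : (∀ a, β (e (inl a))) × (∀ b, β (e (inr b))) ≃ᵐ ∀ i, β i` carries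
`(pi (μ ∘ e ∘ inl)) ⊗ (pi (μ ∘ e ∘ inr))` to `pi μ` (Mathlib `measurePreserving_piCongrLeft`, `measurePreserving_sumPiEquivProdPi_symm`).  Everything is read off that:
* §1 `sumReindex_apply_inl ∕ _inr` — coordinates of `Ψ`: `Ψ z (e (inl a)) = z.1 a`, `Ψ z (e (inr b)) = z.2 b` (Mathlib `Equiv.piCongrLeft_sumInl ∕ _sumInr`);
  `measurePreserving_sumReindex`.
* §2 `integral_pi_eq_integral_prod_sumReindex` (hypothesis-free change of variables), `integrable_comp_sumReindex_iff`.
* §3 COORDINATEWISE READERS — the form the orbital-integral bookkeeping consumes: for readers `r i : β i → M` into a FIXED type `M` and `Fn : (ι → M) → E`,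
  `∫ g, Fn (fun i => r i (g i)) d(pi μ) = ∫ z, Fn (fun i => Sum.elim (fun a => r _ (z.1 a)) (fun b => r _ (z.2 b)) (e.symm i)) d(pi ⊗ pi)` — no dependent casts survive
  (`integral_pi_readers_eq_integral_prod_sumReindex`), and its FUBINI form `integral_pi_readers_eq_integral_integral_sumReindex` (outer `ι₁`, inner `ι₂`; Mathlib `integral_prod`)
  under integrability of the transported integrand, with the integrability transfer `integrable_readers_sumReindex_iff`.
Fubini for the Bochner integral [vanDoorn2021HaarMeasure, §4 Thm. 3]; finitary products [vanDoorn2021HaarMeasure, §7]; [Rudin1987, Thm. 8.8].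

## References
* [vanDoorn2021HaarMeasure] F. van Doorn, *Formalized Haar Measure*, ITP 2021, LIPIcs 193, 18:1–18:17, §4 Thm. 3 (p. 8), §7 (p. 15).
* [Rudin1987] W. Rudin, *Real and Complex Analysis*, 3rd ed. (1987), Thm. 8.8.
-/

set_option autoImplicit false

noncomputable section

open MeasureTheory MeasureTheory.Measure Set Function Sum

namespace Literature.MeasureTheory.Constructions

section SumReindex

variable {ι ι₁ ι₂ : Type*} [Fintype ι] [Fintype ι₁] [Fintype ι₂] {β : ι → Type*} [∀ i, MeasurableSpace (β i)]
  (μ : ∀ i, Measure (β i)) [∀ i, SigmaFinite (μ i)] (e : ι₁ ⊕ ι₂ ≃ ι)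
  {E : Type*} [NormedAddCommGroup E] [NormedSpace ℝ E]

/-! ### §1 Coordinates and measure preservation of the sum reindexing -/

omit [Fintype ι] [Fintype ι₁] [Fintype ι₂] [∀ i, MeasurableSpace (β i)] in
/-- Coordinates of the sum reindexing on the first summand: `Ψ z (e (inl a)) = z.1 a`. [cite: vanDoorn2021HaarMeasure, §7 finitary product measures (p. 15)] -/
theorem sumReindex_apply_inl [∀ i, MeasurableSpace (β i)] (z : (∀ a : ι₁, β (e (inl a))) × (∀ b : ι₂, β (e (inr b)))) (a : ι₁) :
    MeasurableEquiv.piCongrLeft β e ((MeasurableEquiv.sumPiEquivProdPi (fun s => β (e s))).symm z) (e (inl a)) = z.1 a := by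
  rw [MeasurableEquiv.coe_piCongrLeft, MeasurableEquiv.coe_sumPiEquivProdPi_symm]
  exact Equiv.piCongrLeft_sumInl β e z.1 z.2 a

omit [Fintype ι] [Fintype ι₁] [Fintype ι₂] [∀ i, MeasurableSpace (β i)] in
/-- Coordinates of the sum reindexing on the second summand: `Ψ z (e (inr b)) = z.2 b`. [cite: vanDoorn2021HaarMeasure, §7 finitary product measures (p. 15)] -/
theorem sumReindex_apply_inr [∀ i, MeasurableSpace (β i)] (z : (∀ a : ι₁, β (e (inl a))) × (∀ b : ι₂, β (e (inr b)))) (b : ι₂) :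
    MeasurableEquiv.piCongrLeft β e ((MeasurableEquiv.sumPiEquivProdPi (fun s => β (e s))).symm z) (e (inr b)) = z.2 b := by
  rw [MeasurableEquiv.coe_piCongrLeft, MeasurableEquiv.coe_sumPiEquivProdPi_symm]
  exact Equiv.piCongrLeft_sumInr β e z.1 z.2 b

/-- **The sum reindexing is measure preserving**: `Ψ = piCongrLeft β e ∘ (sumPiEquivProdPi (β ∘ e)).symm` carries `(pi (μ ∘ e ∘ inl)) ⊗ (pi (μ ∘ e ∘ inr))` to `pi μ`.
[cite: vanDoorn2021HaarMeasure, §7 finitary product measures (p. 15)] -/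
theorem measurePreserving_sumReindex :
    MeasurePreserving (fun z : (∀ a : ι₁, β (e (inl a))) × (∀ b : ι₂, β (e (inr b))) =>
        MeasurableEquiv.piCongrLeft β e ((MeasurableEquiv.sumPiEquivProdPi (fun s => β (e s))).symm z))
      ((Measure.pi fun a => μ (e (inl a))).prod (Measure.pi fun b => μ (e (inr b)))) (Measure.pi μ) :=
  (measurePreserving_piCongrLeft μ e).comp (measurePreserving_sumPiEquivProdPi_symm fun s => μ (e s))

/-! ### §2 Change of variables and integrability transfer -/

/-- **CHANGE OF VARIABLES along the sum reindexing** (hypothesis-free): `∫ g d(pi μ) = ∫ z, g (Ψ z) d((pi (μ ∘ e ∘ inl)) ⊗ (pi (μ ∘ e ∘ inr)))`.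
[cite: vanDoorn2021HaarMeasure, §7 finitary product measures (p. 15)] -/
theorem integral_pi_eq_integral_prod_sumReindex (g : (∀ i, β i) → E) :
    ∫ x, g x ∂Measure.pi μ =
      ∫ z : (∀ a : ι₁, β (e (inl a))) × (∀ b : ι₂, β (e (inr b))),
        g (MeasurableEquiv.piCongrLeft β e ((MeasurableEquiv.sumPiEquivProdPi (fun s => β (e s))).symm z))
        ∂(Measure.pi fun a => μ (e (inl a))).prod (Measure.pi fun b => μ (e (inr b))) := by
  rw [integral_pi_comp_piCongrLeft μ e g]
  exact ((measurePreserving_sumPiEquivProdPi_symm fun s => μ (e s)).integral_comp' _).symm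

omit [NormedSpace ℝ E] in
/-- Integrability transfers along the sum reindexing. [cite: vanDoorn2021HaarMeasure, §7 finitary product measures (p. 15)] -/
theorem integrable_comp_sumReindex_iff (g : (∀ i, β i) → E) :
    Integrable (fun z : (∀ a : ι₁, β (e (inl a))) × (∀ b : ι₂, β (e (inr b))) =>
        g (MeasurableEquiv.piCongrLeft β e ((MeasurableEquiv.sumPiEquivProdPi (fun s => β (e s))).symm z)))
        ((Measure.pi fun a => μ (e (inl a))).prod (Measure.pi fun b => μ (e (inr b)))) ↔
      Integrable g (Measure.pi μ) :=
  (measurePreserving_sumReindex μ e).integrable_comp_emb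
    ((MeasurableEquiv.sumPiEquivProdPi (fun s => β (e s))).symm.trans (MeasurableEquiv.piCongrLeft β e)).measurableEmbedding

/-! ### §3 Coordinatewise readers: no dependent casts, then Fubini -/

omit [Fintype ι] [Fintype ι₁] [Fintype ι₂] [∀ i, MeasurableSpace (β i)] in
/-- Reading the reindexed point coordinatewise through readers into a fixed type: `r i (Ψ z i) = Sum.elim (r ∘ z.1) (r ∘ z.2) (e.symm i)`.
[cite: vanDoorn2021HaarMeasure, §7 finitary product measures (p. 15)] -/
theorem readers_sumReindex_apply [∀ i, MeasurableSpace (β i)] {M : Type*} (r : ∀ i, β i → M)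
    (z : (∀ a : ι₁, β (e (inl a))) × (∀ b : ι₂, β (e (inr b)))) (i : ι) :
    r i (MeasurableEquiv.piCongrLeft β e ((MeasurableEquiv.sumPiEquivProdPi (fun s => β (e s))).symm z) i) =
      Sum.elim (fun a => r (e (inl a)) (z.1 a)) (fun b => r (e (inr b)) (z.2 b)) (e.symm i) := by
  obtain ⟨s, rfl⟩ := e.surjective i
  rw [Equiv.symm_apply_apply]
  rcases s with a | b
  · rw [sumReindex_apply_inl, Sum.elim_inl]
  · rw [sumReindex_apply_inr, Sum.elim_inr]

/-- **COORDINATEWISE READERS.**  For readers `r i : β i → M` into a fixed type and `Fn : (ι → M) → E`: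
`∫ g, Fn (fun i => r i (g i)) d(pi μ) = ∫ z, Fn (fun i => Sum.elim (fun a => r _ (z.1 a)) (fun b => r _ (z.2 b)) (e.symm i)) d((pi (μ ∘ e ∘ inl)) ⊗ (pi (μ ∘ e ∘ inr)))`.
(The orbital bookkeeping: `β w = G_w`, `r w g = ↑↑(g γ_w g⁻¹) ∈ M₃(ℂ)`, `Fn` the inner integral of the isolated family.) [cite: vanDoorn2021HaarMeasure, §7 finitary product measures (p. 15)] -/
theorem integral_pi_readers_eq_integral_prod_sumReindex {M : Type*} (r : ∀ i, β i → M) (Fn : (ι → M) → E) :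
    ∫ g, Fn (fun i => r i (g i)) ∂Measure.pi μ =
      ∫ z : (∀ a : ι₁, β (e (inl a))) × (∀ b : ι₂, β (e (inr b))),
        Fn (fun i => Sum.elim (fun a => r (e (inl a)) (z.1 a)) (fun b => r (e (inr b)) (z.2 b)) (e.symm i))
        ∂(Measure.pi fun a => μ (e (inl a))).prod (Measure.pi fun b => μ (e (inr b))) := by
  rw [integral_pi_eq_integral_prod_sumReindex μ e]
  refine integral_congr_ae (Filter.Eventually.of_forall fun z => ?_)
  simp only [readers_sumReindex_apply]

omit [NormedSpace ℝ E] in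
/-- Integrability of the reader integrand transfers along the sum reindexing. [cite: vanDoorn2021HaarMeasure, §7 finitary product measures (p. 15)] -/
theorem integrable_readers_sumReindex_iff {M : Type*} (r : ∀ i, β i → M) (Fn : (ι → M) → E) :
    Integrable (fun z : (∀ a : ι₁, β (e (inl a))) × (∀ b : ι₂, β (e (inr b))) =>
        Fn (fun i => Sum.elim (fun a => r (e (inl a)) (z.1 a)) (fun b => r (e (inr b)) (z.2 b)) (e.symm i)))
        ((Measure.pi fun a => μ (e (inl a))).prod (Measure.pi fun b => μ (e (inr b)))) ↔
      Integrable (fun g : ∀ i, β i => Fn (fun i => r i (g i))) (Measure.pi μ) := by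
  rw [← integrable_comp_sumReindex_iff μ e]
  refine integrable_congr (Filter.Eventually.of_forall fun z => ?_)
  simp only [readers_sumReindex_apply]

/-- **COORDINATEWISE READERS, FUBINI FORM** (outer integral over the `ι₁`-block, inner over the `ι₂`-block): if the transported integrand is integrable for the product measure,
`∫ g, Fn (fun i => r i (g i)) d(pi μ) = ∫ x, ∫ y, Fn (fun i => Sum.elim (fun a => r _ (x a)) (fun b => r _ (y b)) (e.symm i)) d(pi (μ ∘ e ∘ inr)) d(pi (μ ∘ e ∘ inl))`.
[cite: vanDoorn2021HaarMeasure, §4 Thm. 3 (p. 8)] [cite: Rudin1987, Thm. 8.8] -/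
theorem integral_pi_readers_eq_integral_integral_sumReindex {M : Type*} (r : ∀ i, β i → M) (Fn : (ι → M) → E)
    (hint : Integrable (fun z : (∀ a : ι₁, β (e (inl a))) × (∀ b : ι₂, β (e (inr b))) =>
        Fn (fun i => Sum.elim (fun a => r (e (inl a)) (z.1 a)) (fun b => r (e (inr b)) (z.2 b)) (e.symm i)))
        ((Measure.pi fun a => μ (e (inl a))).prod (Measure.pi fun b => μ (e (inr b))))) :
    ∫ g, Fn (fun i => r i (g i)) ∂Measure.pi μ =
      ∫ x : (∀ a : ι₁, β (e (inl a))), ∫ y : (∀ b : ι₂, β (e (inr b))),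
        Fn (fun i => Sum.elim (fun a => r (e (inl a)) (x a)) (fun b => r (e (inr b)) (y b)) (e.symm i))
        ∂(Measure.pi fun b => μ (e (inr b))) ∂(Measure.pi fun a => μ (e (inl a))) := by
  rw [integral_pi_readers_eq_integral_prod_sumReindex μ e r Fn, integral_prod _ hint]

/-- **COORDINATEWISE READERS, FUBINI FORM from integrability on `pi μ`.** [cite: vanDoorn2021HaarMeasure, §4 Thm. 3 (p. 8)] [cite: Rudin1987, Thm. 8.8] -/
theorem integral_pi_readers_eq_integral_integral_sumReindex_of_integrable {M : Type*} (r : ∀ i, β i → M) (Fn : (ι → M) → E)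
    (hint : Integrable (fun g : ∀ i, β i => Fn (fun i => r i (g i))) (Measure.pi μ)) :
    ∫ g, Fn (fun i => r i (g i)) ∂Measure.pi μ =
      ∫ x : (∀ a : ι₁, β (e (inl a))), ∫ y : (∀ b : ι₂, β (e (inr b))),
        Fn (fun i => Sum.elim (fun a => r (e (inl a)) (x a)) (fun b => r (e (inr b)) (y b)) (e.symm i))
        ∂(Measure.pi fun b => μ (e (inr b))) ∂(Measure.pi fun a => μ (e (inl a))) :=
  integral_pi_readers_eq_integral_integral_sumReindex μ e r Fn ((integrable_readers_sumReindex_iff μ e r Fn).2 hint)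

end SumReindex

end Literature.MeasureTheory.Constructions

end
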